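import Summits.BirchSwinnertonDyer.BirchSwinnertonDyer.Theorems.AdditiveKolyvaginRoadShaEigenParity
import Summits.BirchSwinnertonDyer.BirchSwinnertonDyer.Theorems.GenusKolyvaginAtTwoPowDvdShaCardAtTwoRTRungDescentTwin
import Literature.NumberTheory.EllipticCurves.SelmerTorsionTwistRestriction
import Literature.NumberTheory.EllipticCurves.SelmerProofs
import Literature.NumberTheory.EllipticCurves.ShaTorsion
import Literature.NumberTheory.EllipticCurves.Sha
import HarnessLib

/-!
# Route `GenusKolyvaginAtTwo`, crux U_T `ShaCardDvdPowAtTwoRT` (stmt-BirchSwinnertonDyer-23658), LINE 19 `rational_pair_descent` v1.1,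
# stub SANDWICH′ input (AΨ): THE Ш-LEVEL TWIST TRANSPORT `H¹(K, E^{(c)}_K) ≃ H¹(K, E_K)` WITH ITS SIGN `Ψ ∘ τ′_* = −τ_* ∘ Ψ`

Seat `bsd-line-gk2-p4` g22 (WIDTH-5 attach, cell `bsd-f1-sign2`), `--supports stmt-BirchSwinnertonDyer-23658` (helper; closes nothing).
THEOREMS ONLY (no definition, no named fact, no instance, no `sorry`).  BSD is NOT proved by any of this; U_T is NOT proved
(SANDWICH′ and the declared RESIDUAL remain open); nothing is closed.

WHY (LEAD gk2-p1 g19, bus 2026-08-29T22:59:44Z).  The LEAD's road for (A) `#(1 − τ_*) Ш(E/K)[2^∞] ≤ 2^(ord₂ c(Wd))` is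
«twist iso `H¹(K,E) ≅ H¹(K,Wd)` with `τ ↦ −τ′`, `(1−τ)X ≅ (1+τ′)X′ = res′ cor′ X′ ⊆ res′(R′)`, `#R′ ≤ #Ш(Wd/ℚ)[2^∞] · 2^DEF`
(gk2-p3 g26 (R′) p749982) with `Ш(Wd/ℚ)[2^∞] = 0` (gk2-p5 g29 p749751)».  The tree has the twist isomorphism with its sign only at
FINITE level (`Literature.hPsiKT`, `conjAct_hPsiKT`: `σ₀·hPsiKT y = −hPsiKT(σ₀·y)` on `H¹(K, ·[n])`).  This file supplies the `H¹(K, E)`-level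
(«Ш-level») transport the road needs:

* §1 (generic, `V • W₁ = W₂` over a field / number field) `mem_localRestrictionKer_iff_h1Equiv_twistPointsIso_mem`,
  `mem_sha_iff_h1Equiv_twistPointsIso_mem` — the `H¹(K, E)`-isomorphism `h1Equiv (twistPointsIso hV)` of isomorphic curves respects
  every local kernel and `Ш` (the `galH1` analogue of Literature `mem_selmerLocalKer_iff_h1TorsionIso_mem`; same local square
  `pointsMap_twistPointsIso`).
* §2 (`E = W/ℚ`, `K = ℚ(θ)` quadratic, `θ² = c`, `σ ≠ 1`) **`exists_galH1_twistTransport`**: there is an additive isomorphism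
  `Ψ : H¹(K, E^{(c)}_K) ≃+ H¹(K, E_K)` (the composite of the two `h1Equiv (twistPointsIso ·)` through `(W^{(1)})_K`, i.e. the
  `galH1` shadow of `hPsiKT`) with (i) `x ∈ Ш ↔ Ψ x ∈ Ш`; (ii) `Ψ ∘ ι′_n = ι_n ∘ hPsiKT_n` at every level `n`
  (`torsionH1ToH1_h1TorsionIso` twice); (iii) **`Ψ (τ′_* x) = −τ_* (Ψ x)`** for EVERY `x` (`H¹(K, ·)` is torsion, `isTorsion_galH1`;
  a torsion class is `ι′_n y`, `range_torsionH1ToH1_eq_torsionBy_of_charZero`; then (ii), `torsionH1ToH1_conjH1` on both curves and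
  `conjAct_hPsiKT`, `eq_sigmaQ_of_ne_one`), where `τ_* = (isLiftOfAut_liftAut σ).conjH1Points W`, `τ′_*` the same for `W^{(c)}`;
  (iv) hence `Ψ (x + τ′_* x) = Ψ x − τ_* (Ψ x)`: **`Ψ` carries `(1 + τ′_*) X′` onto `(1 − τ_*) Ψ(X′)`**, `X′ = Ш(E^{(c)}/K)[2^∞] ↦ X = Ш(E/K)[2^∞]`.

References: [SilvermanAEC2009] X.§4, X.5 Cor. 5.4; [GrossLMS1991] §5 (5.1); [Dokchitser2013ParityNotes] §4; [SerreGaloisCohomology1997]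
I.§2.2 Cor. 3, I.§2.4, I.§5.8; [Kramer1981] §2.
-/

set_option autoImplicit false
-- the Theorems namespace of this sub repeats the summit name by design (D-0017 nested layout)
set_option linter.dupNamespace false

noncomputable section

open scoped Classical

namespace Summit.BirchSwinnertonDyer.BirchSwinnertonDyer.Theorems.GenusExact.PlusDescent

open WeierstrassCurve NumberField IsDedekindDomain Field Literature.NumberTheory.EllipticCurves
  Literature.NumberTheory.GaloisRepresentations Literature.NumberTheory.QuadraticFields
open Summit.BirchSwinnertonDyer.BirchSwinnertonDyer.Theorems.AdditiveKoly

universe u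

/-! ## §1 `H¹(K, E)` and `Ш` under an isomorphism of curves `V • W₁ = W₂` -/

section Iso

variable {F : Type u} [Field F] {W₁ W₂ : WeierstrassCurve F} {V : VariableChange F}

/-- **The local kernels of isomorphic curves correspond on `H¹(F, E)`**: for `V • W₁ = W₂` and any `F`-field `E`, a class dies in
`H¹(E, W₁)` iff its image under `h1Equiv (twistPointsIso hV)` dies in `H¹(E, W₂)` (`mem_resKer_iff_h1Equiv_mem` on the local square
`pointsMap_twistPointsIso`). [cite: SilvermanAEC2009, X.§4] -/
theorem mem_localRestrictionKer_iff_h1Equiv_twistPointsIso_mem (hV : V • W₁ = W₂) (E : Type u) [Field E] [Algebra F E]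
    (x : W₁.galH1) :
    x ∈ W₁.localRestrictionKer E ↔ h1Equiv (twistPointsIso hV) (twistPointsIso_smul hV) x ∈ W₂.localRestrictionKer E :=
  mem_resKer_iff_h1Equiv_mem (resGal (K := F) E) (pointsMap W₁ E) (pointsMap_smul W₁ E) (pointsMap W₂ E) (pointsMap_smul W₂ E)
    (twistPointsIso hV) (twistPointsIso_smul hV) (twistLocalIso E hV) (twistLocalIso_smul E hV) (pointsMap_twistPointsIso E hV) x

end Iso

section IsoNumberField

variable {F : Type} [Field F] [NumberField F] {W₁ W₂ : WeierstrassCurve F} {V : VariableChange F}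

/-- **Isomorphic curves have corresponding `Ш` inside `H¹(F, E)`** (place by place, §1). [cite: SilvermanAEC2009, X.§4] -/
theorem mem_sha_iff_h1Equiv_twistPointsIso_mem (hV : V • W₁ = W₂) (x : W₁.galH1) :
    x ∈ W₁.sha ↔ h1Equiv (twistPointsIso hV) (twistPointsIso_smul hV) x ∈ W₂.sha := by
  rw [mem_sha_iff, mem_sha_iff]
  refine and_congr (forall_congr' fun v ↦ ?_) (forall_congr' fun w ↦ ?_)
  · exact mem_localRestrictionKer_iff_h1Equiv_twistPointsIso_mem hV _ x
  · exact mem_localRestrictionKer_iff_h1Equiv_twistPointsIso_mem hV _ x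

end IsoNumberField

/-! ## §2 The Ш-level twist transport `Ψ : H¹(K, E^{(c)}_K) ≃+ H¹(K, E_K)` and its sign -/

section Twist

variable (W : WeierstrassCurve ℚ) (K : Type) [Field K] [NumberField K] (h2 : Module.finrank ℚ K = 2)
  {θ : K} {c : ℚ} (hθ : θ ∉ Set.range (algebraMap ℚ K)) (hc : θ ^ 2 = algebraMap ℚ K c)

include h2 in
/-- **THE Ш-LEVEL TWIST TRANSPORT WITH ITS SIGN.**  `E = W/ℚ`, `K = ℚ(θ)` quadratic with `θ² = c`, `σ ∈ Gal(K/ℚ)` non-trivial,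
`τ_* := (isLiftOfAut_liftAut σ).conjH1Points W` on `H¹(K, E_K)` and `τ′_*` the same on `H¹(K, E^{(c)}_K)`.  There is an additive
isomorphism `Ψ : H¹(K, E^{(c)}_K) ≃+ H¹(K, E_K)` (induced by the `K`-isomorphism `E^{(c)}_K ≅ E_K`; the `galH1` shadow of `hPsiKT`) with
(i) `x ∈ Ш(E^{(c)}_K) ↔ Ψ x ∈ Ш(E_K)`; (ii) `Ψ (ι′_n y) = ι_n (hPsiKT_n y)` for every level `n` and `y ∈ H¹(K, E^{(c)}_K[n])`
(`ι = torsionH1ToH1`); (iii) **`Ψ (τ′_* x) = −τ_* (Ψ x)`** for every `x`; (iv) `Ψ (x + τ′_* x) = Ψ x − τ_* (Ψ x)` for every `x`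
(so `Ψ` maps `(1 + τ′_*) X′` onto `(1 − τ_*) Ψ X′`). [cite: SilvermanAEC2009, X.5 Cor. 5.4 and X.§4] [cite: GrossLMS1991, §5 (5.1)]
[cite: Dokchitser2013ParityNotes, §4] -/
theorem exists_galH1_twistTransport (σ : K ≃ₐ[ℚ] K) (hσ : σ ≠ 1) :
    ∃ Ψ : ((W.quadraticTwist c).baseChange K).galH1 ≃+ (W.baseChange K).galH1,
      (∀ x, x ∈ ((W.quadraticTwist c).baseChange K).sha ↔ Ψ x ∈ (W.baseChange K).sha) ∧
      (∀ (n : ℤ) (y : galH1Torsion ((W.quadraticTwist c).baseChange K) n),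
        Ψ (torsionH1ToH1 ((W.quadraticTwist c).baseChange K) n y) = torsionH1ToH1 (W.baseChange K) n (hPsiKT W K hθ hc n y)) ∧
      (∀ x, Ψ ((isLiftOfAut_liftAut σ).conjH1Points (W.quadraticTwist c) x) =
        -((isLiftOfAut_liftAut σ).conjH1Points W (Ψ x))) ∧
      (∀ x, Ψ (x + (isLiftOfAut_liftAut σ).conjH1Points (W.quadraticTwist c) x) =
        Ψ x - (isLiftOfAut_liftAut σ).conjH1Points W (Ψ x)) := by
  -- the two changes of variables over `K`: `E^{(c)}_K ≅ E^{(1)}_K ≅ E_K`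
  set Φ₁ := h1Equiv (twistPointsIso (twistUntwist_smul_baseChange W hθ hc))
    (twistPointsIso_smul (twistUntwist_smul_baseChange W hθ hc)) with hΦ₁
  set Φ₂ := h1Equiv (twistPointsIso (map_smul_baseChange_eq_quadraticTwist_one W (sqChange_spec W) (K := K)))
    (twistPointsIso_smul (map_smul_baseChange_eq_quadraticTwist_one W (sqChange_spec W) (K := K))) with hΦ₂
  -- (ii) the Kummer compatibility
  have hii : ∀ (n : ℤ) (y : galH1Torsion ((W.quadraticTwist c).baseChange K) n),
      (Φ₁.trans Φ₂.symm) (torsionH1ToH1 ((W.quadraticTwist c).baseChange K) n y) =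
        torsionH1ToH1 (W.baseChange K) n (hPsiKT W K hθ hc n y) := by
    intro n y
    rw [AddEquiv.trans_apply, AddEquiv.symm_apply_eq, hΦ₁, hΦ₂,
      ← torsionH1ToH1_h1TorsionIso n (twistUntwist_smul_baseChange W hθ hc) y, hPsiKT, AddEquiv.trans_apply,
      ← torsionH1ToH1_h1TorsionIso n (map_smul_baseChange_eq_quadraticTwist_one W (sqChange_spec W) (K := K)),
      AddEquiv.apply_symm_apply]
  -- (iii) the sign, through a finite level
  have hiii : ∀ x, (Φ₁.trans Φ₂.symm) ((isLiftOfAut_liftAut σ).conjH1Points (W.quadraticTwist c) x) =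
      -((isLiftOfAut_liftAut σ).conjH1Points W ((Φ₁.trans Φ₂.symm) x)) := by
    intro x
    -- `x` is torsion, hence a class `ι′_n y`
    obtain ⟨m, hmpos, hmx⟩ := (isOfFinAddOrder_iff_nsmul_eq_zero).mp (((W.quadraticTwist c).baseChange K).isTorsion_galH1 x)
    have hn : ((m : ℕ) : ℤ) ≠ 0 := by exact_mod_cast hmpos.ne'
    have hxmem : x ∈ AddSubgroup.torsionBy ((W.quadraticTwist c).baseChange K).galH1 ((m : ℕ) : ℤ) :=
      AddSubgroup.torsionBy.nsmul_iff.mpr hmx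
    rw [← ((W.quadraticTwist c).baseChange K).range_torsionH1ToH1_eq_torsionBy_of_charZero hn] at hxmem
    obtain ⟨y, rfl⟩ := hxmem
    have hσQ := eq_sigmaQ_of_ne_one K h2 σ hσ hθ hc
    rw [← torsionH1ToH1_conjH1 (W.quadraticTwist c) (isLiftOfAut_liftAut σ), IsLiftOfAut.conjH1_eq_conjAct, hii, hii,
      ← torsionH1ToH1_conjH1 W (isLiftOfAut_liftAut σ), IsLiftOfAut.conjH1_eq_conjAct, ← map_neg]
    congr 1
    rw [hσQ, conjAct_hPsiKT W K h2 hθ hc, neg_neg]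
  refine ⟨Φ₁.trans Φ₂.symm, fun x ↦ ?_, hii, hiii, fun x ↦ ?_⟩
  · -- (i) Ш ↔ Ш
    rw [AddEquiv.trans_apply, hΦ₁, mem_sha_iff_h1Equiv_twistPointsIso_mem (twistUntwist_smul_baseChange W hθ hc) x, hΦ₂,
      mem_sha_iff_h1Equiv_twistPointsIso_mem (map_smul_baseChange_eq_quadraticTwist_one W (sqChange_spec W) (K := K))
        ((h1Equiv _ _).symm (h1Equiv _ _ x)),
      AddEquiv.apply_symm_apply]
  · -- (iv)
    rw [map_add, hiii, sub_eq_add_neg]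

end Twist

end Summit.BirchSwinnertonDyer.BirchSwinnertonDyer.Theorems.GenusExact.PlusDescent

end
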